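import Mathlib

/-!
# LevelSlicePairing — the weak-duality PAIRING IDENTITY behind the dual level slices of a conic program, and the
inradius sandwich it implies (hubbard-algo crew (5), D-0042 R2(e); companion of the cell's LEVELSET-M / slice-geometry
diagnostics, p1 TARGET.md §0f; solver-side finite-dimensional linear algebra — NO number and NO bound on any Hubbard
quantity lives here)

HONEST FRAMING: first certified bounds; not a superconductivity verdict. This file is bookkeeping for the level-set
('value-pinned feasibility') reading of the cell's tier-S question: why a projected-gradient polish pinned BELOW the
complementarity pairing of its start converges and one pinned ABOVE it crawls (TARGET §0f, kit j245398 / j245876; FLOAT diagnostics at M = CORE #294, archived under the cell's HOME/hubbard-algo-p1/kit/runs/).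

Setting (the reduced cone-program frame of the cell's dumps, abstracted): a primal row equation `A *ᵥ x + s = b` with
slack `s` (in the program, `s ∈ K`), a dual multiplier `z` satisfying the dual equation `q + Aᵀ *ᵥ z = 0` (in the program,
`z ∈ K*`), primal value `q ⬝ᵥ x`, dual value `-(b ⬝ᵥ z)`. The cone enters ONLY through one scalar hypothesis
`0 ≤ s ⬝ᵥ (z - t • e)` — which is what `s ∈ K`, `z - t•e ∈ K*` give (for the PSD cone: `Z_k ⪰ t·I` in every block,
`e = svec` of the identity) — so nothing about `svec` conventions or block structure is needed.

PROVED: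
* `pairing_identity` — `q ⬝ᵥ x + b ⬝ᵥ z = s ⬝ᵥ z`: the DEPTH of a dual-feasible `z` below the primal value
  (`q⬝x − (−b⬝z)`) IS its complementarity pairing with the primal slack. (At the cell's M instance: depth `e* − value(z)`
  = `⟨s*, z⟩` to 4.6e-9, the dump's own gap — kit j245876.)
* `inradius_le_depth` — if moreover `0 ≤ s ⬝ᵥ (z - t • e)` then `t * (s ⬝ᵥ e) ≤ q ⬝ᵥ x + b ⬝ᵥ z`: a dual point that is
  `t`-interior (blockwise `⪰ t·I`) lies at depth at least `t·⟨s, e⟩ = t·Σ_k tr S*_k`; equivalently the inradius of the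
  depth-`δ` dual slice is `≤ δ / ⟨s*, e⟩` (M: `⟨s*, e⟩ = 499.2`, so `r(5e-4) ≤ 1.0e-6` — every slice the polish visits is thin).
* `depth_nonneg` — with `0 ≤ s ⬝ᵥ z` (i.e. `s ∈ K`, `z ∈ K*`): `-(b ⬝ᵥ z) ≤ q ⬝ᵥ x`, plain weak duality in this frame
  (the any-time BOUND of the cell's polish is this inequality plus an ℓ¹ residual allowance, booked elsewhere).
-/

namespace Summit.Ventures.CertifiedManyBodySolver.HubbardAlg.LevelSlice

open Matrix

variable {m n : Type*} [Fintype m] [Fintype n]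

/-- Pairing identity: primal row equation + dual equation ⟹ `q⬝x + b⬝z = s⬝z`. -/
theorem pairing_identity (A : Matrix m n ℝ) (x q : n → ℝ) (s b : m → ℝ) (z : m → ℝ)
    (hp : A *ᵥ x + s = b) (hd : q + Aᵀ *ᵥ z = 0) :
    q ⬝ᵥ x + b ⬝ᵥ z = s ⬝ᵥ z := by
  have hq : q = -(Aᵀ *ᵥ z) := eq_neg_of_add_eq_zero_left hd
  have h1 : (A *ᵥ x) ⬝ᵥ z = (Aᵀ *ᵥ z) ⬝ᵥ x := by
    rw [dotProduct_comm (A *ᵥ x) z, dotProduct_mulVec, mulVec_transpose]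
  rw [← hp, add_dotProduct, h1, hq, neg_dotProduct]
  ring

/-- Inradius sandwich: a `t`-interior dual point (encoded by `0 ≤ s ⬝ᵥ (z - t • e)`) lies at depth `≥ t·⟨s, e⟩`. -/
theorem inradius_le_depth (A : Matrix m n ℝ) (x q : n → ℝ) (s b e : m → ℝ) (z : m → ℝ) (t : ℝ)
    (hp : A *ᵥ x + s = b) (hd : q + Aᵀ *ᵥ z = 0) (hK : 0 ≤ s ⬝ᵥ (z - t • e)) :
    t * (s ⬝ᵥ e) ≤ q ⬝ᵥ x + b ⬝ᵥ z := by
  rw [pairing_identity A x q s b z hp hd]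
  have : s ⬝ᵥ (z - t • e) = s ⬝ᵥ z - t * (s ⬝ᵥ e) := by
    rw [dotProduct_sub, dotProduct_smul, smul_eq_mul]
  linarith [this ▸ hK]

/-- Weak duality in this frame: `s ∈ K`, `z ∈ K*` (encoded by `0 ≤ s ⬝ᵥ z`) ⟹ dual value `≤` primal value. -/
theorem depth_nonneg (A : Matrix m n ℝ) (x q : n → ℝ) (s b : m → ℝ) (z : m → ℝ)
    (hp : A *ᵥ x + s = b) (hd : q + Aᵀ *ᵥ z = 0) (hK : 0 ≤ s ⬝ᵥ z) :
    -(b ⬝ᵥ z) ≤ q ⬝ᵥ x := by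
  have := pairing_identity A x q s b z hp hd
  linarith

end Summit.Ventures.CertifiedManyBodySolver.HubbardAlg.LevelSlice
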